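import Mathlib.LinearAlgebra.Matrix.SpecialLinearGroup
import Mathlib.LinearAlgebra.Matrix.ProjectiveSpecialLinearGroup
import Literature.Barriers.MatrixMultiplication.QuasirandomBarrierProofs
import Literature.Barriers.MatrixMultiplication.NilpotentGroupBarrierMatchings
import HarnessLib

/-!
# Barrier (sequel to `QuasirandomBarrier.lean`): from a large second-smallest character degree to
# "no certificate below `2 + ε`" (BCGPU 2023, Cor. 3.3 / §2), and Cor. 3.4 for `SL(n, q)`, `PSL(n, q)`

Topic `Literature/Barriers/MatrixMultiplication` (D-0021 catalogue for the summit
`MatrixMultiplication`, `ω(ℂ) = 2`); third file attached to the catalogue entry `QuasirandomBarrier`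
(Thm. 3.2 = `BCGPU2023_thm32`, PROVED in `QuasirandomBarrierProofs.lean`). That entry's
`scope_caveats:` (b) records that **Cor. 3.4** ("There exists a constant `ε > 0` such that no triple
product property construction in a group of Lie type can yield an upper bound on `ω` better than
`2 + ε`") was "not a Lean statement here (no notion of finite group of Lie type, nor the
Landazuri–Seitz / Fulman–Guralnick bounds, in Mathlib or the tree)". This file supplies:

* **PROVED — the bounded-rank half of the printed proof of Cor. 3.4, for any family** (Cor. 3.3
  composed with the §2 remark "if a family of groups contains no sequence meeting the packing bound,
  then there is a constant `ε > 0` such that no group in the family can prove an upper bound on `ω`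
  better than `2 + ε` via Theorem 2.2"): `noCertificate_of_secondCharDegree_ge` — if
  `n(G) ≥ c|G|^δ` and `|G|` is large (two explicit conditions), then for EVERY exponent `w` with
  `2 ≤ w ≤ 2 + ε`, `ε(3 − δ) < 2δ`, every TPP triple satisfies
  `(|S||T||U|)^{w/3} ≤ |G| ≤ ∑ᵢ dᵢ^w` — the inequality of Thm. 2.2 (= Cohn–Umans 2003 Thm. 4.1 /
  CKSU 2005 Thm. 1.8, the tree's `CKSU2005_thm18`, right-hand side `charDegreePowSum G w`) is then
  CONSISTENT with every `ω ∈ [2, 2 + ε]`, so it certifies nothing below `2 + ε`; and the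
  quantifier form `exists_eps_noCertificate_of_secondCharDegree_ge` (`∀ c, δ > 0 ∃ ε > 0 ∃ N₀ …`).
  Inputs: `BCGPU2023_thm32_holds` (Thm. 3.2, proved) through `BCGPU2023_thm32.cor33`, and
  `card_le_charDegreePowSum` (`|G| = ∑ dᵢ² ≤ ∑ dᵢ^w`, `NilpotentGroupBarrierMatchings.lean`).
* **NAMED FACT — Cor. 3.4 for the groups of Lie type of type `A`**, the family the paper names as
  the example "to keep in mind" (§1, p. 3: "the group `SL(n,q)` of determinant `1` matrices over the
  finite field `𝔽_q`") and the only family of finite groups of Lie type Mathlib can name today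
  (`Matrix.SpecialLinearGroup (Fin n) F`, `Matrix.ProjectiveSpecialLinearGroup (Fin n) F` = the
  quotient by the centre, covered by the remark printed after the proof): `BCGPU2023_cor34_typeA` —
  ONE absolute `ε > 0` such that for every finite field `F` and every `n ≥ 2` (rank `n − 1`
  unbounded, as in print) every TPP triple in `SL(n, F)` or `PSL(n, F)` satisfies Thm. 2.2's
  inequality AT `w = 2 + ε`. Statement only when typed: the printed proof needs
  `n(SL(n,q)) ≥ Ω(q^{n−1})` (Landazuri–Seitz 1974 [LandazuriSeitz1974]) and `k(SL(n,q)) = O(q^{n−1})`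
  conjugacy classes (Fulman–Guralnick 2012 [FulmanGuralnick2012]; the tree held only the `GL(n,q)`
  class number, `FulmanGuralnick2012_prop35`).  UPDATE (2026-08-27): **DISCHARGED** —
  `BCGPU2023_cor34_typeA_holds` in `QuasirandomBarrierLieTypeProofs.lean`, from Landazuri–Seitz
  Lemma 3.1 for `SL_n(𝔽_q)` PROVED in
  `Literature/RepresentationTheory/FiniteGroups/SLnMinimalCharacterDegree.lean` and the elementary
  class-number bound `k(GL_n(q)) ≤ (2q)ⁿ` PROVED in `GLnClassNumberBound.lean` (so `k(SL_n(q)) ≤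
  (q−1)(2q)ⁿ`); the fact stays a `def` (tree convention) and users are fed `BCGPU2023_cor34_typeA_holds`.
  Sequels: `QuasirandomBarrierLieTypeC.lean` (type `C`: `Sp(2n, q) = Matrix.symplecticGroup (Fin n) F`
  and `PSp(2n, q)`, named fact `BCGPU2023_cor34_typeC`) and `QuasirandomBarrierGLn.lean` (the §3.2
  remarks on the full linear groups `GL(n, q)`, PROVED).

Source: J. Blasiak, H. Cohn, J. A. Grochow, K. Pratt, C. Umans, *Matrix multiplication via matrix
groups*, ITCS 2023, LIPIcs 251, 19:1–19:16 = arXiv:2204.03826 [BlasiakCohnGrochowPrattUmans2023];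
held copy `paper:arxiv-2204.03826` read with `lit read` this session (pages = chunks of the held
14-page text): §1.1 p. 3 ("We start by showing that triple product property constructions in groups
of Lie type cannot prove any bound on `ω` better than `2+ε` for some absolute constant `ε > 0`"),
§2 p. 5 (Thm. 2.2, Def. 2.3 and the remark quoted above), §3.1 p. 6 (Def. 3.1, Thm. 3.2, Cor. 3.3,
Cor. 3.4 with its proof: "First, we deal with the case of groups of Lie type of bounded rank. Such
groups `G` satisfy `n(G) ≥ Ω(|G|^δ)` for some constant `δ>0`, as one can check from the bounds given
in [Landazuri–Seitz], and this condition suffices by Cor. 3.3. Now let `G` be a group of Lie type of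
rank `r` and dimension `d` over `𝔽_q`. Then `|G| = Θ(q^d)` …, `n(G) ≥ Ω(q^r)` … Hence
`|S||T||U| ≤ |G|^{3/2}/√n(G) + |G| = O(q^{3d/2 − r/2})`. By [Fulman–Guralnick], there are `O(q^r)`
conjugacy classes in `G`. … `∑ᵢ dᵢ^ω ≥ Ω(q^{r+ω(d−r)/2})`, and therefore Thm. 2.2 cannot yield an
upper bound on `ω` better than `ω ≤ 3(r + log_q C)/r` … If `r` is large enough, then this bound
cannot approach `2`, and the case of bounded `r` was dealt with above."), p. 7 ("Note that this
corollary holds not just for groups of Lie type, but also for simple groups that are quotients of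
groups of Lie type by their centers.").

## Rendering and wording risks

* "Yield an upper bound on `ω` better than `2 + ε` via Thm. 2.2" is rendered, as in every sibling
  entry of this catalogue (`BlasiakChurchCohnGrochowNaslundSawinUmans2017_B`,
  `BCCGU2017_cor320`, `Sawin2018_thm15`; see `NilpotentGroupBarrier` scope_caveats (a), (h)), by
  the effective reading "**the inequality of Thm. 2.2 HOLDS at `w = 2 + ε`**":
  `(|S||T||U|)^{(2+ε)/3} ≤ ∑ᵢ dᵢ^{2+ε} = charDegreePowSum G (2 + ε)`. The proved theorem gives the
  stronger interval form (all `w ∈ [2, 2 + ε]`), which is what the printed argument establishes.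
* `n(G) = secondCharDegree G` (Def. 3.1, `QuasirandomBarrier.lean`), `TripleProductProperty`
  (Cohn–Umans Def. 2.1, right quotient sets, the tree's), "finite nonabelian" = `[Fintype G]` and
  `∃ a b, a * b ≠ b * a` (as in `BCGPU2023_thm32`).
* NOT TYPABLE TODAY, recorded not weakened: Cor. 3.4 for the other families of finite groups of Lie
  type (`SU(n,q)`, `SO(2n+1,q)`, `SO^±(2n,q)`, exceptional and Suzuki–Ree groups: "the fixed points
  of a Steinberg endomorphism in a semisimple algebraic group over a finite field", footnote 2,
  p. 3) — Mathlib has no Steinberg endomorphisms / finite groups of Lie type beyond the matrix groups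
  `SL`, `PSL` and `Sp` (`Matrix.symplecticGroup (Fin n) F = Sp(2n, q)`: Cor. 3.4 for it is the named
  fact `BCGPU2023_cor34_typeC` of `QuasirandomBarrierLieTypeC.lean`, 2026-08-27; Mathlib's
  `Matrix.orthogonalGroup` is the full orthogonal group of the standard form, not the Chevalley group
  `Ω`/`SO`). TODO(general form): `∃ ε > 0, ∀ G of Lie type (simple algebraic group, any isogeny type,
  any `q`), …` once the notion exists. The reading "simple algebraic group" (one absolute `ε`; no
  uniformity over direct powers `H(q)^m`) is that of `QuasirandomBarrier` scope_caveats (e).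
* The constant `ε` of Cor. 3.4 is not printed; the fact keeps `∃ ε > 0`.

WHAT THIS IS NOT: no statement about `ω`; nothing about STPP families (see
`QuasirandomBarrierSTPP.lean` for the perfect-group STPP form of Thm. 3.2), direct powers
`SL(n,q)^m` with `m → ∞` (the authors' open question, §5), or alternating groups.
-/

noncomputable section

open scoped BigOperators

namespace Literature.Barriers.MatrixMultiplication

open Literature.RepresentationTheory.FiniteGroups Literature.Combinatorics.Additive

/-! ## Cor. 3.3 + §2: quasirandom families certify nothing below `2 + ε` (proved) -/

/-- **BCGPU 2023, Cor. 3.3 with the §2 remark, effective** (the bounded-rank half of the proof of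
Cor. 3.4: "Such groups `G` satisfy `n(G) ≥ Ω(|G|^δ)` for some constant `δ>0` … and this condition
suffices by Cor. 3.3"; §2: failing the packing bound forces "a constant `ε>0` such that no group in
the family can prove an upper bound on `ω` better than `2+ε` via Thm. 2.2"). Let `G` be finite
non-abelian with `n(G) ≥ c|G|^δ` (`c > 0`), let `ε ≥ 0`, and suppose `|G|` is large in the sense
`2/√c ≤ |G|^{3/(2+ε) − (3−δ)/2}` and `2 ≤ |G|^{3/(2+ε) − 1}` (both exponents are positive as soon as
`ε(3 − δ) < 2δ` and `ε < 1`). Then for every TPP triple `S, T, U` and EVERY `w ∈ [2, 2 + ε]`,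
`(|S||T||U|)^{w/3} ≤ ∑ᵢ dᵢ^w` — Thm. 2.2's inequality holds throughout `[2, 2 + ε]`, so it cannot
certify `ω < 2 + ε`. Proof: Thm. 3.2 (`BCGPU2023_thm32_holds.cor33`) gives
`|S||T||U| ≤ |G|^{(3−δ)/2}/√c + |G| ≤ |G|^{3/(2+ε)} ≤ |G|^{3/w}`, and `|G| = ∑ dᵢ² ≤ ∑ dᵢ^w`
(`card_le_charDegreePowSum`). [cite: BlasiakCohnGrochowPrattUmans2023, Cor. 3.3 and Cor. 3.4 (proof, first paragraph) and §2 (after Def. 2.3)] -/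
theorem noCertificate_of_secondCharDegree_ge (G : Type) [Group G] [Fintype G]
    (hG : ∃ a b : G, a * b ≠ b * a) {c δ ε : ℝ} (hc : 0 < c) (hε : 0 ≤ ε)
    (hn : c * (Fintype.card G : ℝ) ^ δ ≤ secondCharDegree G)
    (h1 : 2 / Real.sqrt c ≤ (Fintype.card G : ℝ) ^ (3 / (2 + ε) - (3 / 2 - δ / 2)))
    (h2 : 2 ≤ (Fintype.card G : ℝ) ^ (3 / (2 + ε) - 1))
    (S T U : Finset G) (hTPP : TripleProductProperty S T U) {w : ℝ} (hw2 : 2 ≤ w)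
    (hwε : w ≤ 2 + ε) :
    ((S.card * T.card * U.card : ℕ) : ℝ) ^ (w / 3) ≤ charDegreePowSum G w := by
  set g : ℝ := (Fintype.card G : ℝ) with hgdef
  have hg1 : (1 : ℝ) ≤ g := by
    have h := Fintype.card_pos (α := G)
    rw [hgdef]
    exact_mod_cast h
  have hg0 : 0 < g := lt_of_lt_of_le one_pos hg1
  set N : ℝ := ((S.card * T.card * U.card : ℕ) : ℝ) with hNdef
  have hN0 : 0 ≤ N := Nat.cast_nonneg _
  set a : ℝ := 3 / 2 - δ / 2 with ha
  set b : ℝ := 3 / (2 + ε) with hb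
  have h2ε : 0 < 2 + ε := by linarith
  -- Thm. 3.2 / Cor. 3.3: `N ≤ g^a/√c + g`
  have hcor : N ≤ g ^ a / Real.sqrt c + g := BCGPU2023_thm32_holds.cor33 G hG hc hn S T U hTPP
  have hsc : 0 < Real.sqrt c := Real.sqrt_pos.2 hc
  have hga : 0 < g ^ a := Real.rpow_pos_of_pos hg0 a
  -- first largeness condition: `g^a/√c ≤ g^b/2`
  have step1 : g ^ a / Real.sqrt c ≤ g ^ b / 2 := by
    have h := mul_le_mul_of_nonneg_left h1 hga.le
    rw [← Real.rpow_add hg0, show a + (b - a) = b by ring] at h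
    -- `h : g^a * (2/√c) ≤ g^b`
    calc g ^ a / Real.sqrt c = g ^ a * (2 / Real.sqrt c) / 2 := by ring
      _ ≤ g ^ b / 2 := by linarith
  -- second largeness condition: `g ≤ g^b/2`
  have step2 : g ≤ g ^ b / 2 := by
    have e : g ^ b = g * g ^ (b - 1) := by
      have h := Real.rpow_add hg0 1 (b - 1)
      rwa [Real.rpow_one, show (1 : ℝ) + (b - 1) = b by ring] at h
    have h := mul_le_mul_of_nonneg_left h2 hg0.le
    rw [← e] at h
    linarith
  have hNle : N ≤ g ^ b := by
    calc N ≤ g ^ a / Real.sqrt c + g := hcor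
      _ ≤ g ^ b / 2 + g ^ b / 2 := add_le_add step1 step2
      _ = g ^ b := by ring
  have hw3 : 0 ≤ w / 3 := by linarith
  have hb0 : 0 ≤ b := div_nonneg (by norm_num) h2ε.le
  have hb1 : b * ((2 + ε) / 3) = 1 := by
    rw [hb, div_mul_div_comm, mul_comm 3 (2 + ε), div_self (mul_pos h2ε three_pos).ne']
  have hbw : b * (w / 3) ≤ 1 := by
    calc b * (w / 3) ≤ b * ((2 + ε) / 3) := mul_le_mul_of_nonneg_left (by linarith) hb0
      _ = 1 := hb1
  calc N ^ (w / 3) ≤ (g ^ b) ^ (w / 3) := Real.rpow_le_rpow hN0 hNle hw3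
    _ = g ^ (b * (w / 3)) := by rw [← Real.rpow_mul hg0.le]
    _ ≤ g ^ (1 : ℝ) := Real.rpow_le_rpow_of_exponent_le hg1 hbw
    _ = g := Real.rpow_one g
    _ ≤ charDegreePowSum G w := card_le_charDegreePowSum G hw2

/-- **BCGPU 2023, Cor. 3.3 ⇒ "no `ω = 2`", quantifier form** ("No sequence `G₁, G₂, …` of finite
groups satisfying `n(Gᵢ) ≥ Ω(|Gᵢ|^δ)` with `δ>0` can meet the packing bound", and meeting the packing
bound "is a necessary condition for Thm. 2.2 to yield `ω=2`: if a family of groups contains no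
sequence meeting the packing bound, then there is a constant `ε>0` such that no group in the family
can prove an upper bound on `ω` better than `2+ε` via Thm. 2.2"): for all `c, δ > 0` there are
`ε > 0` (here `ε = min(δ/3, 1/2)`) and `N₀` such that in every finite non-abelian group with
`|G| ≥ N₀` and `n(G) ≥ c|G|^δ`, every TPP triple satisfies `(|S||T||U|)^{w/3} ≤ ∑ᵢ dᵢ^w` for all
`w ∈ [2, 2 + ε]`. [cite: BlasiakCohnGrochowPrattUmans2023, Cor. 3.3 and §2 (after Def. 2.3)] -/
theorem exists_eps_noCertificate_of_secondCharDegree_ge {c δ : ℝ} (hc : 0 < c) (hδ : 0 < δ) :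
    ∃ ε : ℝ, 0 < ε ∧ ∃ N₀ : ℝ, ∀ (G : Type) [Group G] [Fintype G], (∃ a b : G, a * b ≠ b * a) →
      N₀ ≤ Fintype.card G → c * (Fintype.card G : ℝ) ^ δ ≤ secondCharDegree G →
      ∀ (S T U : Finset G), TripleProductProperty S T U → ∀ w : ℝ, 2 ≤ w → w ≤ 2 + ε →
        ((S.card * T.card * U.card : ℕ) : ℝ) ^ (w / 3) ≤ charDegreePowSum G w := by
  set ε : ℝ := min (δ / 3) (1 / 2) with hεdef
  have hε0 : 0 < ε := lt_min (by linarith) (by norm_num)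
  have hε1 : ε ≤ δ / 3 := min_le_left _ _
  have hε2 : ε ≤ 1 / 2 := min_le_right _ _
  have h2ε : 0 < 2 + ε := by linarith
  set b : ℝ := 3 / (2 + ε) with hb
  set a : ℝ := 3 / 2 - δ / 2 with ha
  have hab : a < b := by
    rw [hb, ha, lt_div_iff₀ h2ε]
    nlinarith [mul_pos hδ hε0]
  have hba : 0 < b - a := sub_pos.2 hab
  have hb1 : 0 < b - 1 := by
    rw [hb, sub_pos, lt_div_iff₀ h2ε]
    linarith
  refine ⟨ε, hε0, max ((2 / Real.sqrt c) ^ (b - a)⁻¹) (2 ^ (b - 1)⁻¹), ?_⟩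
  intro G _ _ hG hN hn S T U hTPP w hw2 hwε
  refine noCertificate_of_secondCharDegree_ge G hG hc hε0.le hn ?_ ?_ S T U hTPP hw2 hwε
  · have hx : 0 ≤ 2 / Real.sqrt c := by positivity
    calc 2 / Real.sqrt c = ((2 / Real.sqrt c) ^ (b - a)⁻¹) ^ (b - a) :=
          (Real.rpow_inv_rpow hx hba.ne').symm
      _ ≤ (Fintype.card G : ℝ) ^ (b - a) :=
          Real.rpow_le_rpow (by positivity) ((le_max_left _ _).trans hN) hba.le
  · calc (2 : ℝ) = ((2 : ℝ) ^ (b - 1)⁻¹) ^ (b - 1) :=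
          (Real.rpow_inv_rpow (by norm_num) hb1.ne').symm
      _ ≤ (Fintype.card G : ℝ) ^ (b - 1) :=
          Real.rpow_le_rpow (by positivity) ((le_max_right _ _).trans hN) hb1.le

/-! ## Cor. 3.4 for the type-`A` families `SL(n, q)`, `PSL(n, q)` (named fact) -/

/-- **BCGPU 2023, Corollary 3.4, restricted to type `A`** (p. 6: "There exists a constant `ε>0`
such that no triple product property construction in a group of Lie type can yield an upper bound
on `ω` better than `2+ε`"; p. 7: "this corollary holds not just for groups of Lie type, but also
for simple groups that are quotients of groups of Lie type by their centers"). Lean statement: ONE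
absolute `ε > 0` such that for every finite field `F` (any `q = |F|`) and every `n ≥ 2` (rank
`n − 1`, unbounded as in print), every triple `S, T, U` with the triple product property
(Cohn–Umans Def. 2.1, the tree's `TripleProductProperty`) in `SL(n, F)`
(`Matrix.SpecialLinearGroup (Fin n) F`), respectively in `PSL(n, F) = SL(n, F)/Z`
(`Matrix.ProjectiveSpecialLinearGroup (Fin n) F`), satisfies the inequality of Thm. 2.2
(= Cohn–Umans 2003 Thm. 4.1 / CKSU 2005 Thm. 1.8, the tree's `CKSU2005_thm18`) AT the exponent
`w = 2 + ε`: `(|S||T||U|)^{(2+ε)/3} ≤ ∑ᵢ dᵢ^{2+ε}` (`charDegreePowSum`), i.e. Thm. 2.2 cannot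
certify `ω < 2 + ε` from it (the catalogue's effective reading, as for
`BlasiakChurchCohnGrochowNaslundSawinUmans2017_B` and `BCCGU2017_cor320`). Printed proof: bounded
rank by Cor. 3.3 (`n(G) ≥ Ω(|G|^δ)`, Landazuri–Seitz; the tree's
`exists_eps_noCertificate_of_secondCharDegree_ge`), large rank `r = n − 1` by `n(G) ≥ Ω(q^r)`
(Landazuri–Seitz 1974) and `O(q^r)` conjugacy classes (Fulman–Guralnick 2012) with convexity of
`x ↦ x^{ω/2}`, giving at best `ω ≤ 3(r + log_q C)/r`. Typed as a statement; since PROVED: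
`BCGPU2023_cor34_typeA_holds` (`QuasirandomBarrierLieTypeProofs.lean`, with Landazuri–Seitz Lemma 3.1
for `SL_n(𝔽_q)` from `SLnMinimalCharacterDegree.lean` and `k(GL_n(q)) ≤ (2q)ⁿ` from
`GLnClassNumberBound.lean`). Type `C` (`Sp(2n, q)`) is the sibling fact `BCGPU2023_cor34_typeC`; the
other Lie types (`SU`, `SO`, exceptional, Suzuki–Ree) are not expressible in Mathlib today — see the
module docstring; TODO(general form). [cite: BlasiakCohnGrochowPrattUmans2023, Cor. 3.4] -/
def BCGPU2023_cor34_typeA : Prop :=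
  ∃ ε : ℝ, 0 < ε ∧ ∀ (F : Type) [Field F] [Fintype F] (n : ℕ), 2 ≤ n →
    (∀ (S T U : Finset (Matrix.SpecialLinearGroup (Fin n) F)), TripleProductProperty S T U →
      ((S.card * T.card * U.card : ℕ) : ℝ) ^ ((2 + ε) / 3) ≤
        charDegreePowSum (Matrix.SpecialLinearGroup (Fin n) F) (2 + ε)) ∧
    (∀ (S T U : Finset (Matrix.ProjectiveSpecialLinearGroup (Fin n) F)),
      TripleProductProperty S T U →
      ((S.card * T.card * U.card : ℕ) : ℝ) ^ ((2 + ε) / 3) ≤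
        charDegreePowSum (Matrix.ProjectiveSpecialLinearGroup (Fin n) F) (2 + ε))

/-- Projection of `BCGPU2023_cor34_typeA` on `SL(n, F)`: with the fact's `ε`, every TPP triple in
every `SL(n, F)`, `n ≥ 2`, `F` a finite field, satisfies Thm. 2.2's inequality at `w = 2 + ε`.
[cite: BlasiakCohnGrochowPrattUmans2023, Cor. 3.4] -/
theorem BCGPU2023_cor34_typeA.sl (h : BCGPU2023_cor34_typeA) :
    ∃ ε : ℝ, 0 < ε ∧ ∀ (F : Type) [Field F] [Fintype F] (n : ℕ), 2 ≤ n →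
      ∀ (S T U : Finset (Matrix.SpecialLinearGroup (Fin n) F)), TripleProductProperty S T U →
        ((S.card * T.card * U.card : ℕ) : ℝ) ^ ((2 + ε) / 3) ≤
          charDegreePowSum (Matrix.SpecialLinearGroup (Fin n) F) (2 + ε) := by
  obtain ⟨ε, hε, h⟩ := h
  exact ⟨ε, hε, fun F _ _ n hn => (h F n hn).1⟩

/-- Projection of `BCGPU2023_cor34_typeA` on the central quotients `PSL(n, F)` ("also for simple
groups that are quotients of groups of Lie type by their centers").
[cite: BlasiakCohnGrochowPrattUmans2023, Cor. 3.4 (remark following the proof)] -/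
theorem BCGPU2023_cor34_typeA.psl (h : BCGPU2023_cor34_typeA) :
    ∃ ε : ℝ, 0 < ε ∧ ∀ (F : Type) [Field F] [Fintype F] (n : ℕ), 2 ≤ n →
      ∀ (S T U : Finset (Matrix.ProjectiveSpecialLinearGroup (Fin n) F)),
        TripleProductProperty S T U →
        ((S.card * T.card * U.card : ℕ) : ℝ) ^ ((2 + ε) / 3) ≤
          charDegreePowSum (Matrix.ProjectiveSpecialLinearGroup (Fin n) F) (2 + ε) := by
  obtain ⟨ε, hε, h⟩ := h
  exact ⟨ε, hε, fun F _ _ n hn => (h F n hn).2⟩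

end Literature.Barriers.MatrixMultiplication

end
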